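import Summits.ValiantsHypothesis.ValiantsHypothesis.Theorems.GrenetZeonDualUnipotentThreeHalvesLongMassNilSpaceSandwich
import Summits.ValiantsHypothesis.ValiantsHypothesis.Theorems.GrenetZeonDualUnipotentThreeHalvesLongMassNilSpaceWords

/-!
# `GrenetZeon.DualUnipotentThreeHalves` (stmt-ValiantsHypothesis-24318), line `slow_core`, stub (c) `SlowCore.LongMassSlowLawInv`:
# CEILING U2♭ IN THE REGISTERED CURRENCY — `RelCert n m N (n·(H − 2) + codim K)` from the pure index condition on `K`

The ceilings of record for the (c)-price (✓ `…LongMassCeilings`: U1 freeze `μ`, U2 absorb `n·(H−1)`, U3 window cap `n² − n`) are stated for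
PENCILS (`SlowCore.Ledger` / `SlowCore.RelCert`).  ✓ `NilSpaceWords.window_of_pow_succ_eq_zero` (TOP-WINDOW CRITERION, submodule currency)
says that one step below U2 the deep mode is vacuous.  Here is that ceiling in the registered currency:

* `map_lineSubst_eq_pointMat_add_smul` — the line of an AFFINE pencil: `N(x + s v) = N(x)·C + s·(lin v)·C` in `M_m(ℂ[s])`;
* ★★ `ledger_of_linMat_pow_succ_eq_zero` — for an affine pencil with `N ^ H = 0` and `H ≤ k + 2`: every direction space `K` whose linear parts
  satisfy `(lin v)^{k+1} = 0` (`v ∈ K`) is a whole-pencil LEDGER of order `k`;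
* ★★ `relCert_topWindow` — **U2♭**: `RelCert n m N (n·(H − 2) + (n² − dim K))` for every such `K` (with `k = H − 2`): the price is at most
  `n·(H−2) +` the least codimension of a direction space on which the linear parts have nil-index `≤ H − 1` — the pure (RelMMS) quantity,
  no mixed-word condition at this order (U2 itself is ✓ `Ceilings.relCert_absorb_of_pow_eq_zero`).

HONEST FRAMING.  A one-step ceiling (`--supports stmt-ValiantsHypothesis-24318`); NOT progress on (c) `SlowCore.LongMassSlowLawInv` (RESEARCH — OPEN);
closes no stub; S3, 24318, 8062 and `VP ≠ VNP` are NOT proved.  Def-free, no named facts, no sorry.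
-/

set_option linter.dupNamespace false
set_option autoImplicit false

noncomputable section

namespace Summit.ValiantsHypothesis.ValiantsHypothesis.Theorems.GrenetZeon.NilSpaceWords

open MvPolynomial Matrix
open scoped BigOperators
open Summit.ValiantsHypothesis.ValiantsHypothesis.Cruxes.TwoDimCoefficients.DimTwoCases (AffMat IsAffine)
open Summit.ValiantsHypothesis.ValiantsHypothesis.Theorems.GrenetZeon.RadicalSplit (lineSubst)
open Summit.ValiantsHypothesis.ValiantsHypothesis.Theorems.GrenetZeon.SlowCore (linEntry Ledger RelCert lineSubst_apply_of_le_one)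
open Summit.ValiantsHypothesis.ValiantsHypothesis.Theorems.GrenetZeon.ResolventFlag (pointMat linMat)
open Summit.ValiantsHypothesis.ValiantsHypothesis.Theorems.GrenetZeon.RankRow (pointMat_eq_pointMat_zero_add_linMat linMap linMap_apply)
open Summit.ValiantsHypothesis.ValiantsHypothesis.Theorems.GrenetZeon.NilSpaceSandwich (pow_eq_zero_of_mem_span_pointMat)

variable {n m : ℕ}

/-- The line of an AFFINE pencil in the submodule-currency format: `N(x + s v) = N(x)·C + s · (lin v)·C`. -/
theorem map_lineSubst_eq_pointMat_add_smul (N : AffMat n m) (hN : IsAffine N) (x v : Fin n × Fin n → ℂ) :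
    N.map (lineSubst x v) =
      (pointMat N x).map (C : ℂ → MvPolynomial (Fin 1) ℂ) + (X 0 : MvPolynomial (Fin 1) ℂ) • (linMat N v).map C := by
  refine Matrix.ext fun i j => ?_
  rw [Matrix.map_apply, lineSubst_apply_of_le_one N hN x v i j, Matrix.add_apply, Matrix.map_apply, Matrix.smul_apply,
    Matrix.map_apply, pointMat, Matrix.map_apply, linMat, Matrix.of_apply, smul_eq_mul, mul_comm]

/-- The span of the point values is a nil space of uniform index `≤ H` containing every point value and every linear part. -/
theorem linMat_mem_span_pointMat (N : AffMat n m) (hN : IsAffine N) (v : Fin n × Fin n → ℂ) :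
    linMat N v ∈ Submodule.span ℂ (Set.range (pointMat N)) := by
  have h1 : linMat N v = pointMat N v - pointMat N 0 := by
    rw [pointMat_eq_pointMat_zero_add_linMat N hN v]; abel
  rw [h1]
  exact Submodule.sub_mem _ (Submodule.subset_span ⟨v, rfl⟩) (Submodule.subset_span ⟨0, rfl⟩)

/-- ★★ **LEDGER FROM THE PURE INDEX CONDITION (top window).**  For an affine pencil `N` with `N ^ H = 0` and an order `k` with `H ≤ k + 2`,
every direction space `K` with `(lin v)^{k+1} = 0` for all `v ∈ K` is a whole-pencil ledger of order `k`. -/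
theorem ledger_of_linMat_pow_succ_eq_zero (N : AffMat n m) (hN : IsAffine N) {H k : ℕ} (hnil : N ^ H = 0) (hk : H ≤ k + 2)
    (K : Submodule ℂ (Fin n × Fin n → ℂ)) (hK : ∀ v ∈ K, (linMat N v) ^ (k + 1) = 0) :
    Ledger n m N (fun _ => True) K k := by
  intro x v hv p hp i j _ _
  set V : Submodule ℂ (Matrix (Fin m) (Fin m) ℂ) := Submodule.span ℂ (Set.range (pointMat N)) with hV
  set W : Submodule ℂ (Matrix (Fin m) (Fin m) ℂ) := K.map (linMap N) with hW
  have hVnil : ∀ X ∈ V, X ^ H = 0 := fun X hX => pow_eq_zero_of_mem_span_pointMat N hN hnil hX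
  have hWV : W ≤ V := by
    rintro _ ⟨u, _, rfl⟩
    rw [linMap_apply]
    exact linMat_mem_span_pointMat N hN u
  have hWnil : ∀ w ∈ W, w ^ (k + 1) = 0 := by
    rintro _ ⟨u, hu, rfl⟩
    rw [linMap_apply]
    exact hK u hu
  have hx : pointMat N x ∈ V := Submodule.subset_span ⟨x, rfl⟩
  have hvW : linMat N v ∈ W := ⟨v, hv, linMap_apply N v⟩
  rw [map_lineSubst_eq_pointMat_add_smul N hN x v]
  exact window_of_pow_succ_eq_zero V W n hVnil hWV hk hWnil (pointMat N x) hx (linMat N v) hvW p hp i j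

/-- ★★ **CEILING U2♭ (registered currency).**  For an affine pencil `N` with `N ^ H = 0` and every direction space `K` whose linear parts have
nil-index `≤ H − 1`: `RelCert n m N (n·(H − 2) + (n² − dim K))`. -/
theorem relCert_topWindow (N : AffMat n m) (hN : IsAffine N) {H : ℕ} (hnil : N ^ H = 0)
    (K : Submodule ℂ (Fin n × Fin n → ℂ)) (hK : ∀ v ∈ K, (linMat N v) ^ (H - 1) = 0) :
    RelCert n m N (n * (H - 2) + (n * n - Module.finrank ℂ K)) := by
  rcases Nat.lt_or_ge H 2 with hH | hH
  · -- `H ≤ 1`: the pencil is identically zero; `(⊤-ledger of order 0)` on `K` anyway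
    refine ⟨K, 0, ledger_of_linMat_pow_succ_eq_zero N hN hnil (by omega) K (fun v hv => ?_), by omega⟩
    have h1 : (linMat N v) ^ (H - 1) = 0 := hK v hv
    rw [show H - 1 = 0 by omega, pow_zero] at h1
    rw [zero_add, pow_one, ← Matrix.one_mul (linMat N v), h1, Matrix.zero_mul]
  · refine ⟨K, H - 2, ledger_of_linMat_pow_succ_eq_zero N hN hnil (by omega) K (fun v hv => ?_), le_rfl⟩
    rw [show H - 2 + 1 = H - 1 by omega]
    exact hK v hv

end Summit.ValiantsHypothesis.ValiantsHypothesis.Theorems.GrenetZeon.NilSpaceWords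

end
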